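import Summits.CriticalPhenomena.CardyFormulaZ2.Theses.CardyMagicRigidity
import Literature.Probability.Percolation.CardyFormulaConformalInvariance
import Literature.Probability.Percolation.TriCrossingSandwich
import Literature.Probability.Percolation.BoxCrossingProofs
import Literature.Probability.RandomPlanarGeometry.ConformalRectangleProofs

/-!
# Skeleton line `cluster-shadowing` for crux `LoopsToCrossings` (stmt-CriticalPhenomena-4837)

Route `CardyMagicRigidity` (sub-problem `CardyFormulaZ2`), crux r5
`LoopsToCrossings := X → ∀ R, bond R δ − tri R δ → 0` along `𝓝[>] 0`, with
`X = LoopLimitZ2EqT` (the route target: `d_CN`-universality of the full-plane typed loop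
ensembles of critical bond-`ℤ²` and critical site-`𝕋` percolation, DKKMO's coupling distance
`LoopConfig.cnLawEDist → 0`).

## The line (idea card `Ideas/cluster-shadowing.md`, ideator 1; triage r1: 3 × pass, sharpened)

CLUSTER SHADOWING.  `d_CN`-closeness compares loops as PARAMETRISED curves (`UnbasedLoop.udist`)
and therefore preserves loop IDENTITY: on the good coupling event provided by `X`, every
macroscopic cluster-boundary loop of `ω` (bond-`ℤ²`) has a same-type partner in `ω'` (site-`𝕋`),
distinct macroscopic loops stay distinct, and — once thin "hugging" pairs are excluded on both
sides and clusters are confined to a window — the open `𝕋`-cluster bounded by the partner of the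
outer boundary of an open `ℤ²`-cluster `K` SHADOWS `K`: it contains an open `𝕋`-path inside the
`r`-neighbourhood of any open path of `K`, `r = O(η + ρ)` (`η` = coupling scale, `ρ` = dust
scale).  A G02 crossing of `R` on `ℤ²` thus becomes an open `𝕋`-path `r`-near it, which is a
crossing of any conformal rectangle `Q` having FOUR-SIDED ROOM over `R` (marked sides pushed in,
lateral sides pushed out, away from the corners: Bollobás–Riordan's "shorter–fatter" `G⁺`,
in-tree `MarkedDomain.collarRect`), by the construction-free Claim-19 half
`mem_triCrossing_of_pathIn` (tree) and its bond-`ℤ²` port.  The lemma is lattice- and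
colour-symmetric, so the same shadow gives `tri R ≤ bond Q + ε`.  The return from `Q` to `R` is
paid by SMIRNOV ON `𝕋` (proved in the tree, `hasCrossingLimit_triDomainCrossingProb_holds`) plus
continuity of the conformal modulus of the collar rectangles (Radó), i.e. the merged sandwich
reduction of cards `br-sandwich-diagonal ≈ oracle-sandwich ≈ cardy-sandwich-rado-chart`:
`bond R ≤ tri Rs + ε → F(η_R) + 2ε` and `bond R ≥ tri Rl − ε → F(η_R) − 2ε`, a squeeze
(`hasCrossingLimit_of_squeeze`, proved below) — no Schramm–Smirnov Lemma 6.1, no crossing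
continuity, no a.s.-continuity of crossing events.

The seven stubs (statements = named `Prop`s of this file, restated verbatim by the registered
`theorem stub_… := by sorry`, keyed by `Registered.stub_…` in the composition, as the native
skeleton audit requires hypotheses admissible BY NAME):

* `stub_comparisonRectangles` — ANALYSIS (L): shorter–fatter `Rs` / longer–thinner `Rl` comparison
  rectangles with four-sided room and `ε`-close Cardy values (collar rectangles + Radó).
* `stub_shadowZ2toT` — THE SHADOW LEMMA, bond → site direction (XL⁻, LOAD-BEARING, deterministic,
  two configurations): `IsClose η` + no hugging on both sides + no long arm on both sides +
  four-sided room + a corner-free G02 bond crossing of `R` ⇒ a Bollobás–Riordan good open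
  `𝕋`-path for `Q`.
* `stub_shadowTtoZ2` — its mirror, site → bond (L).
* `stub_goodPathCrossing` — Claim 19 (lower half) with EXPLICIT thinness `τ`, both lattices
  (𝕋: the tree proof with `t₀ = 2τ`; ℤ²: the bond port of `mem_triCrossing_of_pathIn`) (L).
* `stub_noHugging` — PROBABILITY (L): thin cross-type hugging pairs of macroscopic loops are rare
  on bond-`ℤ²` (first moment along the hugged loop + `α₄ > 1`: Kesten 1987 / BKS 1999 Rem. 4.2 /
  GPS 2010 (2.6)); the `𝕋` side is inherited through `X` (hugging transfers across `IsClose`).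
* `stub_armBudget` — PROBABILITY (M): window confinement and corner one-arm smallness, both
  lattices (RSW).
* `stub_couplingAssembly` — MEASURE THEORY (M–L): the five statements above and `X` give the
  two-lattice one-sided transfer with room `ShadowTransfer` (coupling from
  `LoopConfig.exists_coupling_of_cnLawEDist_lt`, union bound, marginals; the template is
  `Disproof.lean` §5 `sandwich_transfer`).

`LoopsToCrossings_of` composes them into the crux BY NAME (kernel-checked, no `sorry`):
`ShadowTransfer` + comparison rectangles + Smirnov-in-tree + squeeze.

## Disproof used (`Cruxes/LoopsToCrossings/Disproof.lean`, cdisprove gen 2, rc 0)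

* §1 `loopsToCrossings_iff` / `tendsto_sub_iff_hasCrossingLimit`: the composition goes through
  exactly this per-rectangle equivalence (re-proved below verbatim; the work file is not imported).
* §2 `loopsToCrossingsWithoutX_iff_cardy`: no `_false_without_` theorem exists for this crux; the
  line uses `X` essentially and ONLY in `stub_couplingAssembly` (the coupling), so it cannot
  collide with a future `LoopsToCrossings_false_without_X`.
* §4 `hits_not_isClose_robust` (crossing-type events are not `d_CN`-robust): honoured — every
  transfer here lands in a target with ROOM (`FourSidedRoom`, width `t ≥ 2r`), and the shadow
  radius `r` absorbs the `η`-instability; no same-quad comparison is ever made.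
* §5 `sandwich_transfer`: `stub_couplingAssembly` is its one-sided, two-quad instance
  (`Em = corner-free crossing of R`, `Ep' = triCrossing Q`).
* §6 `not_uniformCrossingUniversality`: consistent — everything is per rectangle (`∃ δ₀(Q)`,
  `∀ᶠ δ`), no uniformity in `R` is claimed.
* Landed `Negative/` lemmas for this crux: none (nothing to import); `ledger negatives` (7 items):
  no stub restates a refuted statement (0748's refutation = non-degenerate arcs, used positively).
-/

noncomputable section

open Set Filter Metric MeasureTheory
open scoped Topology
open Literature.Probability.RandomPlanarGeometry Literature.Probability.LatticeModels
open Literature.Probability.Percolation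
open UpperHalfPlane (upperHalfPlaneSet)
open Summit.CriticalPhenomena.CardyFormulaZ2.Theses.CardyMagicRigidity

namespace Summit.CriticalPhenomena.CardyFormulaZ2.Cruxes.LoopsToCrossings.ClusterShadowing

/-! ### Vocabulary of the line -/

/-- Critical bond percolation on `ℤ²` (`P_{1/2}`). -/
abbrev PZ : Measure (BondConfig (Site 2)) := bondPercolation (zdGraph 2) half

/-- Critical site percolation on `𝕋` (`P_{1/2}`). -/
abbrev PT : Measure (SiteConfig (Site 2)) := triSitePercolation half

/-- The site-`𝕋` typed loop configuration at mesh `δ` — VERBATIM the lambda of the crux / of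
`X = LoopLimitZ2EqT` (honeycomb interface loops `IsSiteInterfaceLoop`, drawn by `siteLoopCurve δ`,
typed by orientation: type `1` ↔ positive shoelace sum ↔ open cluster inside). -/
def triLoopConfig (δ : ℝ) (cfg : SiteConfig (Site 2)) : LoopConfig ℂ :=
  ⟨fun i ↦ {u : UnbasedLoop ℂ | ∃ (v : HexVertex) (γ : hexGraph.Walk v v),
    IsSiteInterfaceLoop cfg γ ∧ (i = 1 ↔ 0 < shoelace (γ.support.map hexCenter)) ∧
    u = UnbasedLoop.mk (BasedLoop.mk (siteLoopCurve δ γ) (isLoop_siteLoopCurve δ γ))}⟩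

/-- `X` unfolds to the vocabulary of this file (definitionally). -/
theorem loopLimitZ2EqT_iff :
    LoopLimitZ2EqT ↔ Tendsto (fun δ : ℝ ↦ LoopConfig.cnLawEDist PZ (bondLoopConfig δ 0) PT (triLoopConfig δ))
      (𝓝[>] 0) (𝓝 0) :=
  Iff.rfl

/-- **Hugging** (cross-type, scale `κ`, diameter threshold `ρ`, window `W`): two loops of
DIFFERENT types, both of diameter `≥ ρ` and drawn inside `B(0, W)`, one lying entirely in the
closed `κ`-neighbourhood of the other's trace.  The configurations this excludes are the thin
rings (a closed ring of width `≤ κ` around an open cluster, or dually) that defeat the canonical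
matching of macroscopic loops across a `d_CN`-coupling (triage r1-1: the "flip" witness). -/
def Hugs (κ ρ W : ℝ) (c : LoopConfig ℂ) : Prop :=
  ∃ i j : Fin 2, i ≠ j ∧ ∃ u ∈ c.F i, ∃ v ∈ c.F j,
    u.range ⊆ ball (0 : ℂ) W ∧ v.range ⊆ ball (0 : ℂ) W ∧
    ρ ≤ diam u.range ∧ ρ ≤ diam v.range ∧ v.range ⊆ cthickening κ u.range

/-- `Hugs` is monotone: widening the collar, lowering the diameter threshold or enlarging the
window keeps a hugging pair hugging (used by STUB 7 to align the scales). -/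
theorem Hugs.mono {κ κ' ρ ρ' W W' : ℝ} (hκ : κ ≤ κ') (hρ : ρ' ≤ ρ) (hW : W ≤ W')
    {c : LoopConfig ℂ} (h : Hugs κ ρ W c) : Hugs κ' ρ' W' c := by
  obtain ⟨i, j, hij, u, hu, v, hv, huW, hvW, hud, hvd, hsub⟩ := h
  exact ⟨i, j, hij, u, hu, v, hv, huW.trans (Metric.ball_subset_ball hW),
    hvW.trans (Metric.ball_subset_ball hW), hρ.trans hud, hρ.trans hvd,
    hsub.trans (Metric.cthickening_mono hκ _)⟩

/-- Traces of `η`-close loops (DKKMO's `d`) have diameters within `2η` of each other. -/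
theorem diam_range_le_of_udist_le {u v : UnbasedLoop ℂ} {η : ℝ} (h : u.udist v ≤ η) :
    diam u.range ≤ diam v.range + 2 * η := by
  have hη : 0 ≤ η := (UnbasedLoop.udist_nonneg u v).trans h
  refine Metric.diam_le_of_forall_dist_le (add_nonneg Metric.diam_nonneg (by positivity))
    fun x hx y hy ↦ ?_
  obtain ⟨x', hx', hxx'⟩ := UnbasedLoop.exists_mem_range_dist_le u v hx
  obtain ⟨y', hy', hyy'⟩ := UnbasedLoop.exists_mem_range_dist_le u v hy
  have hb : Bornology.IsBounded v.range := v.isCompact_range.isBounded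
  have hd : dist x' y' ≤ diam v.range := Metric.dist_le_diam_of_mem hb hx' hy'
  have h1 : dist x x' ≤ η := hxx'.trans h
  have h2 : dist y' y ≤ η := by rw [dist_comm]; exact hyy'.trans h
  calc dist x y ≤ dist x x' + dist x' y' + dist y' y := dist_triangle4 x x' y' y
    _ ≤ η + diam v.range + η := by linarith
    _ = diam v.range + 2 * η := by ring

/-- **Cross-type hugging transfers across `d_CN`-closeness** (the deterministic half of "the `𝕋`
side of no-hugging is inherited from the `ℤ²` side through `X`", STUB 7): if `c` and `c'` are
`η`-close in DKKMO's printed sense and `c'` has a hugging pair inside a window contained in the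
`IsClose` window, then `c` has one at collar `κ + 2η`, threshold `ρ − 2η`, window `W + η` — the
partners of the two loops, which are distinct because their TYPES differ (this is why `Hugs` is
cross-type: same-type partners may coincide, `IsClose` being many-to-one). -/
theorem Hugs.of_isClose {η κ ρ W : ℝ} (hκ : 0 ≤ κ) {c c' : LoopConfig ℂ}
    (hcl : LoopConfig.IsClose η c c') (hW : ball (0 : ℂ) W ⊆ ball 0 (1 / η)) (h : Hugs κ ρ W c') :
    Hugs (κ + 2 * η) (ρ - 2 * η) (W + η) c := by
  obtain ⟨i, j, hij, u', hu', v', hv', huW, hvW, hud, hvd, hsub⟩ := h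
  obtain ⟨u, hu, hdu⟩ := (hcl i).2 u' hu' (huW.trans hW)
  obtain ⟨v, hv, hdv⟩ := (hcl j).2 v' hv' (hvW.trans hW)
  have hdv' : v.udist v' ≤ η := by rwa [UnbasedLoop.udist_comm] at hdv
  refine ⟨i, j, hij, u, hu, v, hv, UnbasedLoop.range_subset_ball_of_udist_le huW hdu,
    UnbasedLoop.range_subset_ball_of_udist_le hvW hdv, ?_, ?_, ?_⟩
  · have := diam_range_le_of_udist_le hdu
    linarith
  · have := diam_range_le_of_udist_le hdv
    linarith
  · intro z hz
    obtain ⟨z', hz', hzz'⟩ := UnbasedLoop.exists_mem_range_dist_le v v' hz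
    have h1 : dist z z' ≤ η := hzz'.trans hdv'
    have hz'u : z' ∈ cthickening κ u'.range := hsub hz'
    rw [u'.isCompact_range.cthickening_eq_biUnion_closedBall hκ] at hz'u
    obtain ⟨w', hw', hz'w'⟩ := Set.mem_iUnion₂.1 hz'u
    rw [Metric.mem_closedBall] at hz'w'
    obtain ⟨w, hw, hww'⟩ := UnbasedLoop.exists_mem_range_dist_le u' u hw'
    have h3 : dist w' w ≤ η := hww'.trans hdu
    refine Metric.mem_cthickening_of_dist_le z w (κ + 2 * η) u.range hw ?_
    calc dist z w ≤ dist z z' + dist z' w' + dist w' w := dist_triangle4 z z' w' w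
      _ ≤ η + κ + η := by linarith
      _ = κ + 2 * η := by ring

/-- An open (primal) path of `ω` on `ℤ²` between two sites (lattice edges only). -/
def ZdOpenPath (ω : BondConfig (Site 2)) (x y : Site 2) : Prop :=
  (openGraph ω ⊓ zdGraph 2).Reachable x y

/-- A dual-open (= primal-closed) path of `ω` on `ℤ²`, dual vertices in the lower-left-corner
coordinates of `dualConfig` (dual vertex `x` = face `x + (½, ½)`). -/
def ZdDualPath (ω : BondConfig (Site 2)) (x y : Site 2) : Prop :=
  (openGraph (dualConfig ω) ⊓ zdGraph 2).Reachable x y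

/-- **Long arm** on `δℤ²`: a primal-open or dual-open path of `ω` from a site drawn in
`B̄(0, W₀)` to a site drawn outside `B(0, W₁)` (its absence confines every primal and dual
cluster meeting `B̄(0, W₀)`, hence every loop around them, to the window). -/
def ZdLongArm (W₀ W₁ δ : ℝ) (ω : BondConfig (Site 2)) : Prop :=
  ∃ x y : Site 2, ‖meshPoint δ x‖ ≤ W₀ ∧ W₁ ≤ ‖meshPoint δ y‖ ∧ (ZdOpenPath ω x y ∨ ZdDualPath ω x y)

/-- **Long arm** on `δ𝕋`: an open-site or closed-site path from `B̄(0, W₀)` to outside `B(0, W₁)`. -/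
def TriLongArm (W₀ W₁ δ : ℝ) (ω : SiteConfig (Site 2)) : Prop :=
  ∃ x y : Site 2, ‖triMeshPoint δ x‖ ≤ W₀ ∧ W₁ ≤ ‖triMeshPoint δ y‖ ∧
    (PathIn triGraph ω x y ∨ PathIn triGraph ωᶜ x y)

/-- **Open arm at a point** on `δℤ²`: an open path from `B̄(z, ρ')` to the complement of `B(z, d)`. -/
def ZdArmAt (z : ℂ) (ρ' d δ : ℝ) (ω : BondConfig (Site 2)) : Prop :=
  ∃ x y : Site 2, dist (meshPoint δ x) z ≤ ρ' ∧ d ≤ dist (meshPoint δ y) z ∧ ZdOpenPath ω x y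

/-- **Open arm at a point** on `δ𝕋`. -/
def TriArmAt (z : ℂ) (ρ' d δ : ℝ) (ω : SiteConfig (Site 2)) : Prop :=
  ∃ x y : Site 2, dist (triMeshPoint δ x) z ≤ ρ' ∧ d ≤ dist (triMeshPoint δ y) z ∧ PathIn triGraph ω x y

/-- Sites of `δℤ²` drawn at distance `≥ ρ'` from the four marked points of `R`. -/
def zdCornerFar (R : ConformalRectangle) (ρ' δ : ℝ) : Set (Site 2) :=
  {w | ∀ i : Fin 4, ρ' ≤ dist (meshPoint δ w) (R.pt i)}

/-- Sites of `δ𝕋` drawn at distance `≥ ρ'` from the four marked points of `R`. -/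
def triCornerFar (R : ConformalRectangle) (ρ' δ : ℝ) : Set (Site 2) :=
  {w | ∀ i : Fin 4, ρ' ≤ dist (triMeshPoint δ w) (R.pt i)}

/-- **Corner-free G02 bond crossing** of `R` on `δℤ²`: G02's event `discreteCrossing` realised by an
open path of `Ω_δ` all of whose sites keep distance `≥ ρ'` from the marked points. -/
def ZdCornerFreeCrossing (R : ConformalRectangle) (ρ' δ : ℝ) (ω : BondConfig (Site 2)) : Prop :=
  ∃ x ∈ discreteArc R.carrier δ (R.arc 0), ∃ y ∈ discreteArc R.carrier δ (R.arc 2),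
    PathIn (openGraph ω ⊓ discreteDomainGraph R.carrier δ) (zdCornerFar R ρ' δ) x y

/-- **Corner-free G02 site crossing** of `R` on `δ𝕋` (G02's `triCrossing` by an open path of
`Ω_δ` keeping distance `≥ ρ'` from the marked points). -/
def TriCornerFreeCrossing (R : ConformalRectangle) (ρ' δ : ℝ) (ω : SiteConfig (Site 2)) : Prop :=
  ∃ x ∈ triDiscreteArc R.carrier δ (R.arc 0), ∃ y ∈ triDiscreteArc R.carrier δ (R.arc 2),
    PathIn (triDiscreteDomainGraph R.carrier δ) (ω ∩ triMeshDomain R.carrier δ ∩ triCornerFar R ρ' δ) x y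

/-- **Bollobás–Riordan's pointwise conditions** (Claim 19 / remark p. 195, as in the tree's
`mem_triCrossing_of_pathIn`) for a lattice point `p` relative to the TARGET rectangle `Q`:
off `Q` it is `τ`-close to `arc 0 ∪ arc 2`; in `Q` it is more than `δ` away from `arc 1 ∪ arc 3`. -/
def BRGood (Q : ConformalRectangle) (τ δ : ℝ) (p : ℂ) : Prop :=
  (p ∉ Q.carrier → infDist p (Q.arc 0) ≤ τ ∨ infDist p (Q.arc 2) ≤ τ) ∧
  (p ∈ Q.carrier → δ < infDist p (Q.arc 1) ∧ δ < infDist p (Q.arc 3))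

/-- **Good open `𝕋`-path for `Q`** (exactly the hypotheses of `mem_triCrossing_of_pathIn Q`, with
thinness `τ`): an open site path whose sites satisfy `BRGood Q τ δ`, from a site off `Q` within
`τ` of `Q.arc 0` to a site off `Q` within `τ` of `Q.arc 2`. -/
def TriGoodPath (Q : ConformalRectangle) (τ δ : ℝ) (ω : SiteConfig (Site 2)) : Prop :=
  ∃ u v : Site 2, triMeshPoint δ u ∉ Q.carrier ∧ infDist (triMeshPoint δ u) (Q.arc 0) ≤ τ ∧
    triMeshPoint δ v ∉ Q.carrier ∧ infDist (triMeshPoint δ v) (Q.arc 2) ≤ τ ∧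
    PathIn triGraph (ω ∩ {w | BRGood Q τ δ (triMeshPoint δ w)}) u v

/-- **Good open `ℤ²`-path for `Q`** (bond analogue: an open lattice path through sites
satisfying `BRGood Q τ δ`, from a site off `Q` near `Q.arc 0` to a site off `Q` near `Q.arc 2`). -/
def ZdGoodPath (Q : ConformalRectangle) (τ δ : ℝ) (ω : BondConfig (Site 2)) : Prop :=
  ∃ u v : Site 2, meshPoint δ u ∉ Q.carrier ∧ infDist (meshPoint δ u) (Q.arc 0) ≤ τ ∧
    meshPoint δ v ∉ Q.carrier ∧ infDist (meshPoint δ v) (Q.arc 2) ≤ τ ∧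
    PathIn (openGraph ω ⊓ zdGraph 2) {w | BRGood Q τ δ (meshPoint δ w)} u v

/-- **Four-sided room** of the target `Q` over the source `R`, width `t`, cap thinness `τ`,
measured off the corner balls `B(R.pt i, ρ')` (Bollobás–Riordan's "shorter–fatter" relation
`G⁺ ⊒ D`, abstracted; triage r1-2/r1-3: inner shortenings are NOT enough — slab-and-finger):
(a) every corner-far point within `t` of `R.arc 0` is off `Q` and within `τ` of `Q.arc 0`, and
likewise for the arcs `2`; (b) every corner-far point within `t` of `closure R` is, if off `Q`,
within `τ` of `Q.arc 0 ∪ Q.arc 2`, and, if in `Q`, farther than `t` from `Q.arc 1 ∪ Q.arc 3`.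
Realised by the collar rectangles `R.collarRect T σ h` (`σ = (-,+,-,+)` for `Q` over `R`,
`σ = (+,-,+,-)` for `R` over `Q`) with `t = t(h, ρ') > 0`, `τ = t + O(h)`. -/
def FourSidedRoom (R Q : ConformalRectangle) (t τ ρ' : ℝ) : Prop :=
  (∀ z : ℂ, (∀ i : Fin 4, ρ' ≤ dist z (R.pt i)) → infDist z (R.arc 0) ≤ t →
      z ∉ Q.carrier ∧ infDist z (Q.arc 0) ≤ τ) ∧
  (∀ z : ℂ, (∀ i : Fin 4, ρ' ≤ dist z (R.pt i)) → infDist z (R.arc 2) ≤ t →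
      z ∉ Q.carrier ∧ infDist z (Q.arc 2) ≤ τ) ∧
  (∀ z : ℂ, (∀ i : Fin 4, ρ' ≤ dist z (R.pt i)) → infDist z (closure R.carrier) ≤ t →
      (z ∉ Q.carrier → infDist z (Q.arc 0) ≤ τ ∨ infDist z (Q.arc 2) ≤ τ) ∧
      (z ∈ Q.carrier → t < infDist z (Q.arc 1) ∧ t < infDist z (Q.arc 3)))

/-- **The transfer with room** (`C⁺` of the idea card in its four-sided form): for every gap `d`
and `ε > 0` there is a corner radius `ρ₀` such that whenever `Q` has four-sided room over `R`
off the `ρ'`-corner balls (`ρ' ≤ ρ₀`), the source arcs are `d`-separated and the target caps are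
thin, then eventually in `δ`: `bond R ≤ tri Q + ε` AND `tri R ≤ bond Q + ε` (G02 events on both
lattices, same mesh).  Derived from the shadow lemmas by `stub_couplingAssembly`; consumed by
`LoopsToCrossings_of`. -/
def ShadowTransfer : Prop :=
  ∀ (d ε : ℝ), 0 < d → 0 < ε → ∃ ρ₀ > 0, ∀ (R Q : ConformalRectangle) (t τ ρ' : ℝ),
    0 < ρ' → ρ' ≤ ρ₀ → 0 < t → 0 ≤ τ → FourSidedRoom R Q t τ ρ' →
    (∀ p ∈ R.arc 0, ∀ q ∈ R.arc 2, d ≤ dist p q) →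
    (∀ p ∈ Q.arc 0, ∀ q ∈ Q.arc 2, 16 * τ < dist p q) →
    ∀ᶠ δ : ℝ in 𝓝[>] 0,
      bondDomainCrossingProb R δ ≤ triDomainCrossingProb Q δ + ε ∧
        triDomainCrossingProb R δ ≤ bondDomainCrossingProb Q δ + ε

/-! ### The seven stub STATEMENTS (named `Prop`s) -/

/-- Statement of STUB 1 (analysis): comparison rectangles with four-sided room. -/
def ComparisonRectangles : Prop :=
  ∀ (R : ConformalRectangle) (φ : ConformalEquiv upperHalfPlaneSet R.carrier) (x : Fin 4 → ℝ),
    R.IsUniformizing φ x → ∀ (ε ρ' d : ℝ), 0 < ε → 0 < ρ' →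
    (∀ p ∈ R.arc 0, ∀ q ∈ R.arc 2, d < dist p q) →
    ∃ (Rs Rl : ConformalRectangle) (φs : ConformalEquiv upperHalfPlaneSet Rs.carrier) (xs : Fin 4 → ℝ)
      (φl : ConformalEquiv upperHalfPlaneSet Rl.carrier) (xl : Fin 4 → ℝ) (t τ : ℝ),
      0 < t ∧ 0 ≤ τ ∧ Rs.IsUniformizing φs xs ∧ Rl.IsUniformizing φl xl ∧
      |Literature.Probability.RandomPlanarGeometry.cardyFunction (crossRatio xs) - Literature.Probability.RandomPlanarGeometry.cardyFunction (crossRatio x)| ≤ ε ∧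
      |Literature.Probability.RandomPlanarGeometry.cardyFunction (crossRatio xl) - Literature.Probability.RandomPlanarGeometry.cardyFunction (crossRatio x)| ≤ ε ∧
      FourSidedRoom R Rs t τ ρ' ∧ FourSidedRoom Rl R t τ ρ' ∧
      (∀ p ∈ Rs.arc 0, ∀ q ∈ Rs.arc 2, 16 * τ < dist p q) ∧
      (∀ p ∈ R.arc 0, ∀ q ∈ R.arc 2, 16 * τ < dist p q) ∧
      (∀ p ∈ Rl.arc 0, ∀ q ∈ Rl.arc 2, d / 2 ≤ dist p q)

/-- Statement of STUB 2 (THE SHADOW LEMMA, bond-`ℤ²` → site-`𝕋`; deterministic). -/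
def ShadowZ2toT : Prop :=
  ∀ (R Q : ConformalRectangle) (δ η κ ρ r t τ ρ' W₀ W₁ : ℝ) (ω : BondConfig (Site 2))
    (ω' : SiteConfig (Site 2)),
    0 < δ → δ ≤ η → 8 * η ≤ κ → 2 * κ ≤ ρ → 8 * ρ ≤ r → 2 * r ≤ t → 2 * r ≤ ρ' →
    FourSidedRoom R Q t τ ρ' →
    cthickening t (closure R.carrier) ⊆ closedBall (0 : ℂ) W₀ → W₀ < W₁ → (W₁ + 3) * η ≤ 1 →
    LoopConfig.IsClose η (bondLoopConfig δ 0 ω) (triLoopConfig δ ω') →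
    ¬ Hugs κ ρ (W₁ + 2) (bondLoopConfig δ 0 ω) → ¬ Hugs κ ρ (W₁ + 2) (triLoopConfig δ ω') →
    ¬ ZdLongArm W₀ W₁ δ ω → ¬ TriLongArm W₀ W₁ δ ω' →
    ZdCornerFreeCrossing R (2 * ρ') δ ω →
    TriGoodPath Q τ δ ω'

/-- Statement of STUB 3 (the shadow lemma, site-`𝕋` → bond-`ℤ²`; deterministic). -/
def ShadowTtoZ2 : Prop :=
  ∀ (R Q : ConformalRectangle) (δ η κ ρ r t τ ρ' W₀ W₁ : ℝ) (ω : BondConfig (Site 2))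
    (ω' : SiteConfig (Site 2)),
    0 < δ → δ ≤ η → 8 * η ≤ κ → 2 * κ ≤ ρ → 8 * ρ ≤ r → 2 * r ≤ t → 2 * r ≤ ρ' →
    FourSidedRoom R Q t τ ρ' →
    cthickening t (closure R.carrier) ⊆ closedBall (0 : ℂ) W₀ → W₀ < W₁ → (W₁ + 3) * η ≤ 1 →
    LoopConfig.IsClose η (bondLoopConfig δ 0 ω) (triLoopConfig δ ω') →
    ¬ Hugs κ ρ (W₁ + 2) (bondLoopConfig δ 0 ω) → ¬ Hugs κ ρ (W₁ + 2) (triLoopConfig δ ω') →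
    ¬ ZdLongArm W₀ W₁ δ ω → ¬ TriLongArm W₀ W₁ δ ω' →
    TriCornerFreeCrossing R (2 * ρ') δ ω' →
    ZdGoodPath Q τ δ ω

/-- Statement of STUB 4 (Claim 19 lower half with explicit thinness, both lattices). -/
def GoodPathCrossing : Prop :=
  (∀ (Q : ConformalRectangle) (τ : ℝ), 0 ≤ τ → (∀ p ∈ Q.arc 0, ∀ q ∈ Q.arc 2, 16 * τ < dist p q) →
    ∃ δ₀ > 0, ∀ δ : ℝ, 0 < δ → δ < δ₀ → ∀ ω : SiteConfig (Site 2), TriGoodPath Q τ δ ω →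
      ω ∈ triCrossing Q.carrier δ (Q.arc 0) (Q.arc 2)) ∧
  (∀ (Q : ConformalRectangle) (τ : ℝ), 0 ≤ τ → (∀ p ∈ Q.arc 0, ∀ q ∈ Q.arc 2, 16 * τ < dist p q) →
    ∃ δ₀ > 0, ∀ δ : ℝ, 0 < δ → δ < δ₀ → ∀ ω : BondConfig (Site 2), ZdGoodPath Q τ δ ω →
      ω ∈ discreteCrossing Q.carrier δ (Q.arc 0) (Q.arc 2))

/-- Statement of STUB 5 (no hugging on bond-`ℤ²`). -/
def NoHugging : Prop :=
  ∀ (W ρ ε : ℝ), 0 < W → 0 < ρ → 0 < ε → ∃ κ₀ > 0, ∀ κ : ℝ, 0 < κ → κ ≤ κ₀ →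
    ∀ᶠ δ : ℝ in 𝓝[>] 0, PZ.real {ω | Hugs κ ρ W (bondLoopConfig δ 0 ω)} ≤ ε

/-- Statement of STUB 6 (window confinement and corner one-arm smallness, both lattices). -/
def ArmBudget : Prop :=
  (∀ (W₀ ε : ℝ), 0 < W₀ → 0 < ε → ∃ W₁ : ℝ, W₀ < W₁ ∧ ∀ᶠ δ : ℝ in 𝓝[>] 0,
      PZ.real {ω | ZdLongArm W₀ W₁ δ ω} ≤ ε ∧ PT.real {ω | TriLongArm W₀ W₁ δ ω} ≤ ε) ∧
  (∀ (d ε : ℝ), 0 < d → 0 < ε → ∃ ρ₀ > 0, ρ₀ < d ∧ ∀ (z : ℂ) (ρ' : ℝ), 0 < ρ' → ρ' ≤ ρ₀ →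
      ∀ᶠ δ : ℝ in 𝓝[>] 0,
        PZ.real {ω | ZdArmAt z ρ' d δ ω} ≤ ε ∧ PT.real {ω | TriArmAt z ρ' d δ ω} ≤ ε)

/-- Statement of STUB 7 (the coupling assembly). -/
def CouplingAssembly : Prop :=
  ShadowZ2toT → ShadowTtoZ2 → GoodPathCrossing → NoHugging → ArmBudget → LoopLimitZ2EqT →
    ShadowTransfer

/-! ### The registered stubs -/

/-- STUB 1 (L, analysis) — **comparison rectangles with four-sided room.**  For every conformal
rectangle `R` with uniformizing datum `(φ, x)`, every `ε > 0`, every corner radius `ρ' > 0` and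
every gap `d` below the distance of the arcs `0`, `2` of `R`, there are a SHORTER–FATTER `Rs`
(`FourSidedRoom R Rs t τ ρ'`) and a LONGER–THINNER `Rl` (`FourSidedRoom Rl R t τ ρ'`) with some
common width `t > 0` and cap thinness `τ ≥ 0`, whose Cardy values are `ε`-close to `F(η_R)`,
with thin target caps (`16 τ <` the arc distance of the targets `Rs`, `R`) and `d/2`-separated
source arcs of `Rl`.  Intended proof: `Rs = R.collarRect T σ h`, `σ = (-1,+1,-1,+1)`,
`Rl = R.collarRect T (-σ) h` (`CollarDomain.lean`, `ConformalTube.lean`: `nonempty_tubeData`,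
`dist_collarLoop_lt`, `tube_mem_collarRect`, `exists_eq_tube_of_mem_of_not_mem_closure`; same
corners `R.pt i`), `h → 0`; the room `t = t(h, ρ') > 0` off the corner balls by compactness of the
two-sided conformal tube; `τ = t + sup dist(∂Ω(s), collar loop(s)) = t + O(h)`; the Cardy values
converge because the collar loops converge uniformly to `∂Ω` with fixed marks (Radó 1923 /
Pommerenke Thm 2.11 + Cor. 2.4: Fréchet convergence ⇒ Riemann maps converge on the closed disc ⇒
cross-ratios converge; `crossRatio_eq_of_isUniformizing_holds`; continuity of `Literature.Probability.RandomPlanarGeometry.cardyFunction`,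
`cardyFunction_props_holds`), alternatively the slow-diagonal trick of card
`br-sandwich-diagonal` (tree: `IsDiscreteApprox`, `exists_scale_tendsto`).  Radó is NOT in the
tree (to vendor as a Literature fact).  Why it might fail: only through a mismatch between this
abstract `FourSidedRoom` and the collar geometry near the corners (then weaken (a)/(b) to what
the collar gives and re-check STUB 2). -/
theorem stub_comparisonRectangles :
    ∀ (R : ConformalRectangle) (φ : ConformalEquiv upperHalfPlaneSet R.carrier) (x : Fin 4 → ℝ),
    R.IsUniformizing φ x → ∀ (ε ρ' d : ℝ), 0 < ε → 0 < ρ' →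
    (∀ p ∈ R.arc 0, ∀ q ∈ R.arc 2, d < dist p q) →
    ∃ (Rs Rl : ConformalRectangle) (φs : ConformalEquiv upperHalfPlaneSet Rs.carrier) (xs : Fin 4 → ℝ)
      (φl : ConformalEquiv upperHalfPlaneSet Rl.carrier) (xl : Fin 4 → ℝ) (t τ : ℝ),
      0 < t ∧ 0 ≤ τ ∧ Rs.IsUniformizing φs xs ∧ Rl.IsUniformizing φl xl ∧
      |Literature.Probability.RandomPlanarGeometry.cardyFunction (crossRatio xs) - Literature.Probability.RandomPlanarGeometry.cardyFunction (crossRatio x)| ≤ ε ∧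
      |Literature.Probability.RandomPlanarGeometry.cardyFunction (crossRatio xl) - Literature.Probability.RandomPlanarGeometry.cardyFunction (crossRatio x)| ≤ ε ∧
      FourSidedRoom R Rs t τ ρ' ∧ FourSidedRoom Rl R t τ ρ' ∧
      (∀ p ∈ Rs.arc 0, ∀ q ∈ Rs.arc 2, 16 * τ < dist p q) ∧
      (∀ p ∈ R.arc 0, ∀ q ∈ R.arc 2, 16 * τ < dist p q) ∧
      (∀ p ∈ Rl.arc 0, ∀ q ∈ Rl.arc 2, d / 2 ≤ dist p q) := by
  sorry

/-- STUB 2 (XL⁻, LOAD-BEARING, deterministic) — **the shadow lemma, bond-`ℤ²` → site-`𝕋`.**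
Two configurations `ω` (bond-`ℤ²`), `ω'` (site-`𝕋`), one mesh `δ`; scales
`δ ≤ η ≪ κ ≪ ρ ≪ r ≪ t, ρ'` (explicit factors `8, 2, 8, 2, 2`).  IF the typed loop
configurations are `η`-close in DKKMO's printed sense (`LoopConfig.IsClose`: every loop inside
`B(0, 1/η)` has a same-type partner at `udist ≤ η`, both ways), neither has a cross-type HUGGING
pair at collar `κ` among loops of diameter `≥ ρ` in `B(0, W₁ + 2)`, neither has a LONG ARM from
`B̄(0, W₀) ⊇ (closure R)_t` to `∂B(0, W₁)` (so all relevant clusters and loops live inside the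
`IsClose` window, `(W₁ + 3) η ≤ 1`), `Q` has four-sided room `t` over `R` off the corner balls
`B(R.pt i, ρ')`, and `ω` has a G02 open crossing of `R` by a path of `Ω_δ` avoiding
`B(R.pt i, 2ρ')` — THEN `ω'` has a Bollobás–Riordan good open `𝕋`-path for `Q` (`TriGoodPath`).
Mechanism (idea card + nesting picture): let `K` be the open cluster of the crossing `π`
(finite, in the window), `θ = ∂K` its outer boundary loop (type 1, diameter `≥` arc distance),
`θ'` its partner, `K'` the open `𝕋`-cluster bounded by `θ'`; loops of diameter `≥ ρ` match
bijectively and nesting-consistently between the two depth-`≤ 1` macroscopic forests because a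
mismatch (a macroscopic hole of `K'` without counterpart, a macroscopic closed `𝕋`-cluster
blocking the `r`-sausage of `π`) forces two distinct cross-type macroscopic loops of one
configuration into the `2η`-collar of each other (= `Hugs (2η+O(δ)) ρ`, excluded since
`8η ≤ κ`), while DUST (loops of diameter `< ρ`) is circumvented through its outer open circuit
of diameter `< ρ + 2δ ≤ r/8 + 2δ` (on `𝕋` the sites adjacent to a closed cluster from outside
are open and connected; on `ℤ²` planar duality).  Hence `K'` contains an open `𝕋`-path inside
`N_r(π)` from `N_r(start π)` to `N_r(end π)`; its sites are `ρ'`-corner-far (`2r ≤ ρ'`), so by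
`FourSidedRoom` (a) its ends are off `Q` within `τ` of `Q.arc 0` / `Q.arc 2`, and by (b) every
site is `BRGood Q τ δ` (`2r ≤ t`; the start of `π` is within `δ` of `R.arc 0` since discrete-arc
vertices are `δ`-close to their arc).  Leans on: `LoopConfig.IsClose`, `UnbasedLoop.udist`,
`hausdorffDist_range_le_udist`, `infDist_range_le_udist`, `range_subset_ball_of_udist_le`,
`UnbasedLoop.wind_eq_or_eq_neg_of_udist_lt` (interior stability off the collar), the ℤ²
loop/cluster dictionary (`bondLoopConfig`, `IsInterfaceLoop`, `loopType`,
`exists_isInterfaceLoop_around_openCluster`, `IsInterfaceLoop.wind_eq_of_reachable`), the 𝕋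
dictionary (`IsSiteInterfaceLoop`, `siteLoopCurve`, `InterfaceLoopPolygon`), `dualConfig`,
`mem_discreteArc_iff`, `PathIn`.  Why it might fail: a dust/gap configuration not covered by
the cross-type hugging exclusion (then strengthen `Hugs` — same-type thin filaments? — and
re-check STUB 5), or a constant among `8,2,8,2,2` too tight (reshape; STUB 7 picks the scales in
the order `t → r → ρ → κ → η → δ`, any fixed factors are admissible). -/
theorem stub_shadowZ2toT :
    ∀ (R Q : ConformalRectangle) (δ η κ ρ r t τ ρ' W₀ W₁ : ℝ) (ω : BondConfig (Site 2))
    (ω' : SiteConfig (Site 2)),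
    0 < δ → δ ≤ η → 8 * η ≤ κ → 2 * κ ≤ ρ → 8 * ρ ≤ r → 2 * r ≤ t → 2 * r ≤ ρ' →
    FourSidedRoom R Q t τ ρ' →
    cthickening t (closure R.carrier) ⊆ closedBall (0 : ℂ) W₀ → W₀ < W₁ → (W₁ + 3) * η ≤ 1 →
    LoopConfig.IsClose η (bondLoopConfig δ 0 ω) (triLoopConfig δ ω') →
    ¬ Hugs κ ρ (W₁ + 2) (bondLoopConfig δ 0 ω) → ¬ Hugs κ ρ (W₁ + 2) (triLoopConfig δ ω') →
    ¬ ZdLongArm W₀ W₁ δ ω → ¬ TriLongArm W₀ W₁ δ ω' →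
    ZdCornerFreeCrossing R (2 * ρ') δ ω →
    TriGoodPath Q τ δ ω' := by
  sorry

/-- STUB 3 (L, deterministic) — **the shadow lemma, site-`𝕋` → bond-`ℤ²`**: the mirror of STUB 2
(same closeness / no-hugging / window / room hypotheses; a corner-free G02 open site crossing of
`R` on `δ𝕋` gives a good open `ℤ²`-path for `Q`).  Same mechanism with the lattices swapped
(honeycomb loops are simple and disjoint, so the `𝕋`-side bookkeeping is the easier one; on the
`ℤ²` side the shadow cluster's open paths use lattice edges of `openGraph ω ⊓ zdGraph 2`).  Used
for the lower bound `tri Rl ≤ bond R + ε`.  Why it might fail: as STUB 2. -/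
theorem stub_shadowTtoZ2 :
    ∀ (R Q : ConformalRectangle) (δ η κ ρ r t τ ρ' W₀ W₁ : ℝ) (ω : BondConfig (Site 2))
    (ω' : SiteConfig (Site 2)),
    0 < δ → δ ≤ η → 8 * η ≤ κ → 2 * κ ≤ ρ → 8 * ρ ≤ r → 2 * r ≤ t → 2 * r ≤ ρ' →
    FourSidedRoom R Q t τ ρ' →
    cthickening t (closure R.carrier) ⊆ closedBall (0 : ℂ) W₀ → W₀ < W₁ → (W₁ + 3) * η ≤ 1 →
    LoopConfig.IsClose η (bondLoopConfig δ 0 ω) (triLoopConfig δ ω') →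
    ¬ Hugs κ ρ (W₁ + 2) (bondLoopConfig δ 0 ω) → ¬ Hugs κ ρ (W₁ + 2) (triLoopConfig δ ω') →
    ¬ ZdLongArm W₀ W₁ δ ω → ¬ TriLongArm W₀ W₁ δ ω' →
    TriCornerFreeCrossing R (2 * ρ') δ ω' →
    ZdGoodPath Q τ δ ω := by
  sorry

/-- STUB 4 (L) — **good paths give G02 crossings** (Bollobás–Riordan Claim 19, lower half, with
EXPLICIT thinness): for a conformal rectangle `Q` and `τ ≥ 0` with `16 τ` below the distance of
`Q.arc 0` and `Q.arc 2`, for all small `δ`, a good open `𝕋`-path (resp. `ℤ²`-path) for `Q`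
contains an open crossing of the LARGEST mesh component `Q_δ` between the discrete arcs, i.e.
realises `triCrossing` (resp. `discreteCrossing`).  𝕋 side: literally the tree proof of
`exists_pathIn_triDiscreteDomainGraph_of_pathIn` / `mem_triCrossing_of_pathIn`
(`TriCrossingSandwich.lean`) with its internal `ε` taken as `8τ` (so `t₀ = τ`) instead of
`Q.exists_pos_forall_lt_dist_arc` — run extraction `PathIn.exists_run`, exits
`NearOut.exists_exit`, bulk `JordanDomain.exists_mem_triMeshDomain_of_reachable`.  ℤ² side: the
bond port (`meshDomain`, `discreteDomainGraph`, `discreteArc`, bulk theorem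
`JordanDomain.exists_forall_mem_meshDomain_and_reachable` (MeshDomainJordan.lean, every Jordan
domain), `exists_exit_of_encloses`, `mem_discreteArc_of_exit`, `mem_discreteCrossing_of_chain`
(BoxCrossingLowerBound.lean)) — card `oracle-sandwich`'s first lemma B1, checked on paper by
triage r1-2/r1-3 for every Jordan `Q`.  X-free, single configuration.  Why it might fail: only
the explicit constant (`16`) — any fixed constant works for the line. -/
theorem stub_goodPathCrossing :
    (∀ (Q : ConformalRectangle) (τ : ℝ), 0 ≤ τ → (∀ p ∈ Q.arc 0, ∀ q ∈ Q.arc 2, 16 * τ < dist p q) →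
      ∃ δ₀ > 0, ∀ δ : ℝ, 0 < δ → δ < δ₀ → ∀ ω : SiteConfig (Site 2), TriGoodPath Q τ δ ω →
        ω ∈ triCrossing Q.carrier δ (Q.arc 0) (Q.arc 2)) ∧
    (∀ (Q : ConformalRectangle) (τ : ℝ), 0 ≤ τ → (∀ p ∈ Q.arc 0, ∀ q ∈ Q.arc 2, 16 * τ < dist p q) →
      ∃ δ₀ > 0, ∀ δ : ℝ, 0 < δ → δ < δ₀ → ∀ ω : BondConfig (Site 2), ZdGoodPath Q τ δ ω →
        ω ∈ discreteCrossing Q.carrier δ (Q.arc 0) (Q.arc 2)) := by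
  sorry

/-- STUB 5 (L, probability; state-of-the-art input) — **no hugging on bond-`ℤ²`**: for every
window `W`, diameter threshold `ρ > 0` and `ε > 0` there is `κ₀ > 0` such that for every collar
`κ ≤ κ₀`, eventually in `δ`, the `P_{1/2}`-probability of a cross-type hugging pair
(`Hugs κ ρ W`) in the loop representation `bondLoopConfig δ 0` is `≤ ε`.  Intended proof
(triage r1-1 (1), r1-2, r1-3 (b)): a hugging pair `v ⊆ N_κ(u)` of different types is a THIN RING
(a closed dual cluster whose outer boundary stays within `κ` of the boundary of its macroscopic
hole, or dually), so EVERY point `y` of `v` sees the ALTERNATING FOUR-ARM event from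
`B(y, 3κ)` to `∂B(y, ρ/4)` (open hole cluster, the ring twice, the open cluster outside); first
moment along `v`: on `Hugs`, at least `ρ/(2κ)` cells of a `κ`-grid of `B(0, W)` see it, so
`P ≤ (2κ/ρ) · (2W/κ)² · π₄(3κ, ρ/4) = O(W² κ^{c} ρ^{-2-c}) → 0` as soon as
`π₄(a, b) ≤ C (a/b)^{1+c}` uniformly in the mesh — the bound `α₄ > 1` for bond-`ℤ²`
(Kesten 1987, via GPS arXiv:0803.3750 eq. (2.6) right half; RSW-only alternative: BKS
arXiv:math/9811157 Thm 4.1 / Remark 4.2, `E[#pivotal edges] ≤ m^{1-1/(3ρ)} (log m)^{3/2}`).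
The `𝕋` side is NOT stated: on the good coupling event it is inherited from this one
(`Hugs κ ρ W (c') ∧ IsClose η c c' ⇒ Hugs (κ + 2η) (ρ − 2η) (W + η) (c)` for cross-type pairs:
`Hugs.of_isClose`, PROVED above; monotonicity `Hugs.mono`, PROVED above).  Leans on: `ArmEvents*`, `ZdPivotalFourArm*`, `ZdFourArm*` (only the
Reimer LOWER bound is in the tree — the upper bound `α₄ > 1` must be proved or vendored),
`FourArmGarban*`, RSW `rsw_half`, the loop/cluster dictionary of STUB 2.  Why it might fail:
`α₄ > 1` on bond-`ℤ²` may only be available as a named fact (then the crux closes conditionally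
on it, or prove BKS Thm 4.1 in the tree); the pointwise four-arm picture needs the ring's
structures to exit `B(y, ρ/4)` (diameters `≥ ρ`, fine). -/
theorem stub_noHugging :
    ∀ (W ρ ε : ℝ), 0 < W → 0 < ρ → 0 < ε → ∃ κ₀ > 0, ∀ κ : ℝ, 0 < κ → κ ≤ κ₀ →
      ∀ᶠ δ : ℝ in 𝓝[>] 0, PZ.real {ω | Hugs κ ρ W (bondLoopConfig δ 0 ω)} ≤ ε := by
  sorry

/-- STUB 6 (M, probability) — **arm budget** on both lattices: (i) WINDOW — for every `W₀` and
`ε > 0` there is `W₁ > W₀` such that eventually in `δ` a primal-open or dual-open (resp. open-site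
or closed-site) path from `B̄(0, W₀)` to `∂B(0, W₁)` has probability `≤ ε` (RSW circuits in the
`log₂(W₁/W₀)` dyadic annuli: `ZdAnnulusCircuitsGeneral`, `rsw_half`, `TriAnnulusCircuit`,
`tri_annulusCrossing_bound_holds`); (ii) CORNERS — for every `d, ε > 0` there is `ρ₀ ∈ (0, d)`
such that for every centre `z` and every `ρ' ≤ ρ₀`, eventually in `δ`, an open path from
`B̄(z, ρ')` to distance `d` has probability `≤ ε` on each lattice (one-arm bound
`C (ρ'/d)^{c}`, uniform in `z`; `OneArmLSW`, `ZdOneArmPowerBound`, `BoxCrossingBounds`).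
Why it might fail: routine; only the uniformity of `ρ₀` in `z` (RSW constants are translation
invariant; the `∀ᶠ δ` may depend on `z`). -/
theorem stub_armBudget :
    (∀ (W₀ ε : ℝ), 0 < W₀ → 0 < ε → ∃ W₁ : ℝ, W₀ < W₁ ∧ ∀ᶠ δ : ℝ in 𝓝[>] 0,
        PZ.real {ω | ZdLongArm W₀ W₁ δ ω} ≤ ε ∧ PT.real {ω | TriLongArm W₀ W₁ δ ω} ≤ ε) ∧
    (∀ (d ε : ℝ), 0 < d → 0 < ε → ∃ ρ₀ > 0, ρ₀ < d ∧ ∀ (z : ℂ) (ρ' : ℝ), 0 < ρ' → ρ' ≤ ρ₀ →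
        ∀ᶠ δ : ℝ in 𝓝[>] 0,
          PZ.real {ω | ZdArmAt z ρ' d δ ω} ≤ ε ∧ PT.real {ω | TriArmAt z ρ' d δ ω} ≤ ε) := by
  sorry

/-- STUB 7 (M–L, measure theory) — **the coupling assembly**: the two shadow lemmas, the
good-path lemma, no-hugging, the arm budget and `X` give `ShadowTransfer`.  Proof plan (the
one-sided two-quad instance of `Disproof.lean` §5 `sandwich_transfer`): given `d, ε` take
`ρ₀ := ρ₀(d/2, ε/16)/2` from STUB 6 (ii); given `R, Q, t, τ, ρ' ≤ ρ₀` with `FourSidedRoom`,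
choose `W₀` with `(closure R)_t ⊆ B̄(0, W₀)` (bounded), `W₁` from STUB 6 (i) (`ε/16`),
`r := min (t/2) (ρ'/2)`, `ρ := r/8`, `κ := min (ρ/2) (κ₀/2)` with `κ₀` from STUB 5 at
`(W₁ + 3, ρ/2, ε/16)`, `η := min (κ/8) (1/(W₁+3)) (ε/16)`; `X` (`loopLimitZ2EqT_iff`) gives
eventually `cnLawEDist < ofReal η`, hence a coupling `P_δ` with marginals `PZ`, `PT` and
`P_δ[¬ IsClose η] < η` (`LoopConfig.exists_coupling_of_cnLawEDist_lt`); no-hugging for the `𝕋`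
configuration at `(κ, ρ, W₁+2)` follows on `IsClose η` from no-hugging of the `ℤ²` one at
`(κ + 2η, ρ − 2η, W₁ + 3)` (`Hugs.of_isClose` + `Hugs.mono`, both proved in this file); for `δ < δ₀(Q)` (STUB 4, both halves) and `δ ≤ η`: on the good event,
`discreteCrossing R` & no open arm at the four corners `ZdArmAt (R.pt i) (2ρ') (d/2)` ⇒
`ZdCornerFreeCrossing R (2ρ')` (a crossing path meeting `B(R.pt i, 2ρ')` exits `B(R.pt i, d/2)`,
its far end being `δ`-close to the opposite arc) ⇒ STUB 2 ⇒ `TriGoodPath Q` ⇒ STUB 4 ⇒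
`triCrossing Q`; symmetrically with STUB 3.  Union bound:
`bond R δ = P_δ(fst⁻¹ C_R) ≤ P_δ(snd⁻¹ C_Q) + P_δ(bad) ≤ tri Q δ + ε`
(`map_measureReal_apply`, `measurableSet_discreteCrossing`; `measurableSet_triCrossing` as in
Disproof §5; `measureReal_union_le` needs no measurability of the bad events).  `X` is used
HERE and only here.  Why it might fail: bookkeeping only (it is the statement's raison d'être
that every estimate it needs is one of STUBS 2–6). -/
theorem stub_couplingAssembly :
    ShadowZ2toT → ShadowTtoZ2 → GoodPathCrossing → NoHugging → ArmBudget → LoopLimitZ2EqT →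
      ShadowTransfer := by
  sorry

/-! ### Consistency: each named statement IS its registered stub (definitionally) -/

theorem comparisonRectangles_holds : ComparisonRectangles := stub_comparisonRectangles
theorem shadowZ2toT_holds : ShadowZ2toT := stub_shadowZ2toT
theorem shadowTtoZ2_holds : ShadowTtoZ2 := stub_shadowTtoZ2
theorem goodPathCrossing_holds : GoodPathCrossing := stub_goodPathCrossing
theorem noHugging_holds : NoHugging := stub_noHugging
theorem armBudget_holds : ArmBudget := stub_armBudget
theorem couplingAssembly_holds : CouplingAssembly := stub_couplingAssembly

/-! ### Name-keyed aliases of the seven statements (the hypotheses of the composition) -/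
namespace Registered

/-- Alias of `ComparisonRectangles` keyed by the registered stub name. -/
abbrev stub_comparisonRectangles : Prop := ComparisonRectangles
/-- Alias of `ShadowZ2toT` keyed by the registered stub name. -/
abbrev stub_shadowZ2toT : Prop := ShadowZ2toT
/-- Alias of `ShadowTtoZ2` keyed by the registered stub name. -/
abbrev stub_shadowTtoZ2 : Prop := ShadowTtoZ2
/-- Alias of `GoodPathCrossing` keyed by the registered stub name. -/
abbrev stub_goodPathCrossing : Prop := GoodPathCrossing
/-- Alias of `NoHugging` keyed by the registered stub name. -/
abbrev stub_noHugging : Prop := NoHugging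
/-- Alias of `ArmBudget` keyed by the registered stub name. -/
abbrev stub_armBudget : Prop := ArmBudget
/-- Alias of `CouplingAssembly` keyed by the registered stub name. -/
abbrev stub_couplingAssembly : Prop := CouplingAssembly

end Registered

/-! ### Proved glue: Smirnov-on-`𝕋` turns the transfer with room into the crux -/

/-- Per rectangle, `bond − tri → 0` iff Cardy's formula for bond-`ℤ²` in that rectangle, because
Smirnov's theorem on `𝕋` is PROVED in the tree for every conformal rectangle
(`hasCrossingLimit_triDomainCrossingProb_holds`) and uniformizing data exist
(`MarkedDomain.exists_isUniformizing_holds`).  Verbatim from `Disproof.lean` §1. -/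
theorem tendsto_sub_iff_hasCrossingLimit (R : ConformalRectangle) :
    Tendsto (fun δ : ℝ ↦ bondDomainCrossingProb R δ - triDomainCrossingProb R δ) (𝓝[>] 0) (𝓝 0) ↔
      R.HasCrossingLimit (bondDomainCrossingProb R) Literature.Probability.RandomPlanarGeometry.cardyFunction := by
  constructor
  · intro h φ x hux
    have htri := hasCrossingLimit_triDomainCrossingProb_holds R φ x hux
    have key := h.add htri
    simp only [sub_add_cancel, zero_add] at key
    exact key
  · intro h
    obtain ⟨φ, x, hux⟩ := MarkedDomain.exists_isUniformizing_holds R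
    have hb := h φ x hux
    have ht := hasCrossingLimit_triDomainCrossingProb_holds R φ x hux
    have key := hb.sub ht
    simp only [sub_self] at key
    exact key

/-- **Squeeze** (real analysis + Smirnov-on-`𝕋`; the assembly shape shared with card
`cardy-sandwich-rado-chart`): if for every `ε > 0` the family `p` is eventually squeezed, up to
`ε`, between the site-`𝕋` crossing probabilities of two conformal rectangles whose Cardy values
are `ε`-close to `F(crossRatio x)`, then `R.HasCrossingLimit p F`. -/
theorem hasCrossingLimit_of_squeeze (R : ConformalRectangle) (p : ℝ → ℝ)
    (hS : ∀ Q : ConformalRectangle, Q.HasCrossingLimit (triDomainCrossingProb Q) Literature.Probability.RandomPlanarGeometry.cardyFunction)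
    (h : ∀ (φ : ConformalEquiv upperHalfPlaneSet R.carrier) (x : Fin 4 → ℝ), R.IsUniformizing φ x →
      ∀ ε > 0, ∃ (Qp Qm : ConformalRectangle) (φp : ConformalEquiv upperHalfPlaneSet Qp.carrier)
        (xp : Fin 4 → ℝ) (φm : ConformalEquiv upperHalfPlaneSet Qm.carrier) (xm : Fin 4 → ℝ),
        Qp.IsUniformizing φp xp ∧ Qm.IsUniformizing φm xm ∧
        |Literature.Probability.RandomPlanarGeometry.cardyFunction (crossRatio xp) - Literature.Probability.RandomPlanarGeometry.cardyFunction (crossRatio x)| ≤ ε ∧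
        |Literature.Probability.RandomPlanarGeometry.cardyFunction (crossRatio xm) - Literature.Probability.RandomPlanarGeometry.cardyFunction (crossRatio x)| ≤ ε ∧
        ∀ᶠ δ in 𝓝[>] (0 : ℝ), p δ ≤ triDomainCrossingProb Qp δ + ε ∧ triDomainCrossingProb Qm δ - ε ≤ p δ) :
    R.HasCrossingLimit p Literature.Probability.RandomPlanarGeometry.cardyFunction := by
  intro φ x hφx
  rw [Metric.tendsto_nhds]
  intro ε hε
  obtain ⟨Qp, Qm, φp, xp, φm, xm, hup, hum, hFp, hFm, hev⟩ := h φ x hφx (ε / 3) (by positivity)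
  have htp := (Metric.tendsto_nhds.1 (hS Qp φp xp hup)) (ε / 3) (by positivity)
  have htm := (Metric.tendsto_nhds.1 (hS Qm φm xm hum)) (ε / 3) (by positivity)
  filter_upwards [hev, htp, htm] with δ hδ hp hm
  rw [Real.dist_eq] at hp hm ⊢
  rw [abs_sub_lt_iff] at hp hm ⊢
  rw [abs_sub_le_iff] at hFp hFm
  constructor <;> linarith [hδ.1, hδ.2]

/-! ### The composition: the seven stubs imply the crux, by name -/

/-- `LoopsToCrossings` from the seven stubs (no `sorry`).  Given `X` and a conformal rectangle `R`:
STUB 7 (fed by STUBS 2–6 and `X`) gives the transfer with room `ShadowTransfer`; by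
`tendsto_sub_iff_hasCrossingLimit` it suffices to prove Cardy for bond-`ℤ²` in `R`, which is the
squeeze `hasCrossingLimit_of_squeeze` between `tri Rs` and `tri Rl` for the comparison rectangles
of STUB 1 (Smirnov on `𝕋` in the tree supplying their limits): `bond R ≤ tri Rs + ε` (transfer
from `R` to the shorter–fatter `Rs`) and `tri Rl ≤ bond R + ε` (transfer from the longer–thinner
`Rl` to `R`). -/
theorem LoopsToCrossings_of (h1 : Registered.stub_comparisonRectangles)
    (h2 : Registered.stub_shadowZ2toT) (h3 : Registered.stub_shadowTtoZ2)
    (h4 : Registered.stub_goodPathCrossing) (h5 : Registered.stub_noHugging)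
    (h6 : Registered.stub_armBudget) (h7 : Registered.stub_couplingAssembly) :
    Summit.CriticalPhenomena.CardyFormulaZ2.Theses.CardyMagicRigidity.LoopsToCrossings := by
  intro hX R
  have hT : ShadowTransfer := h7 h2 h3 h4 h5 h6 hX
  rw [tendsto_sub_iff_hasCrossingLimit]
  refine hasCrossingLimit_of_squeeze R (bondDomainCrossingProb R)
    (fun Q ↦ hasCrossingLimit_triDomainCrossingProb_holds Q) ?_
  intro φ x hux ε hε
  obtain ⟨d, hd, hdist⟩ := R.exists_pos_forall_lt_dist_arc
  obtain ⟨ρ₀, hρ₀, hST⟩ := hT (d / 2) ε (by positivity) hε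
  obtain ⟨Rs, Rl, φs, xs, φl, xl, t, τ, ht, hτ, hus, hul, hFs, hFl, hroom_s, hroom_l, hgap_s, hgap_R,
    hgap_l⟩ := h1 R φ x hux ε ρ₀ d hε hρ₀ hdist
  refine ⟨Rs, Rl, φs, xs, φl, xl, hus, hul, hFs, hFl, ?_⟩
  have hdR : ∀ p ∈ R.arc 0, ∀ q ∈ R.arc 2, d / 2 ≤ dist p q := fun p hp q hq ↦ by
    have := hdist p hp q hq
    linarith
  have e1 := hST R Rs t τ ρ₀ hρ₀ le_rfl ht hτ hroom_s hdR hgap_s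
  have e2 := hST Rl R t τ ρ₀ hρ₀ le_rfl ht hτ hroom_l hgap_l hgap_R
  filter_upwards [e1, e2] with δ he1 he2
  exact ⟨he1.1, by linarith [he2.2]⟩

/-- Wiring check: the registered stubs feed `LoopsToCrossings_of` as stated. -/
example : Summit.CriticalPhenomena.CardyFormulaZ2.Theses.CardyMagicRigidity.LoopsToCrossings :=
  LoopsToCrossings_of stub_comparisonRectangles stub_shadowZ2toT stub_shadowTtoZ2
    stub_goodPathCrossing stub_noHugging stub_armBudget stub_couplingAssembly

end Summit.CriticalPhenomena.CardyFormulaZ2.Cruxes.LoopsToCrossings.ClusterShadowing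

end
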